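import Mathlib
import Summits.ResolutionOfSingularities.ResolutionOfSingularities.Theorems.WeightedInvariantLocalWeightedDropPolyDescentRegimeRank
import Summits.ResolutionOfSingularities.ResolutionOfSingularities.Theorems.WeightedInvariantLocalWeightedDropPolyDescentBridgeExits

/-!
# `WeightedInvariant.LocalWeightedDrop`, the monic polyhedron descent WITH A PREPARATION SELECTOR (ρ-T′, part 1: DEFINITIONS, the LAZY selector,
# labels with `A₀ = 0`)

Crux item stmt-ResolutionOfSingularities-8899 `LocalWeightedDrop` (route `ResolutionOfSingularities/WeightedInvariant`), ENGINE skeleton v32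
(ddb48572591139d5), registered stub `stub_spaceNCRankDrop`; TOT2-LINE v1.2 (`L/res-L1-w43-lead-1/g4/TOT2-LINE.md`), inner assembly, QUESTION Q6 of
res-L1-w43-lead-1 (13:56Z, «old component = maximal-contact plane»: in the sub-regime `y ∈ O` the label has `A₀ = 0` and must NEVER be re-centred, but
`PolyDescent.succT` re-centres by the `ε`-chosen `prepPsi` after every shear) and res-type-056's CHECK (14:00Z, «does ρ-T accept the identity
re-centring on well-prepared labels?»).  [OURS · L1 W4.3 · chain w43 · stub worker res-L1-w43-stub-2 (gen 5); a SELECTOR-GENERIC PORT of the lead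
prover's ρ-T files …PolyDescentShearBeta / …PolyDescentTail / …PolyDescentNoChain / …PolyDescentRegimeRank (res-L1-w43-lead-1 gen 3/4), whose proofs
use `prepPsi` only through its well-preparing property; MODEL Cossart–Jannsen–Saito LNM 2270 Ch. 8/11–13 for `J = (y^d + Σ_{j<d} A_j y^j)`, `e = 2`.
Nothing here is a statement of any manuscript; the games are the programme's own; AI-produced, gate-checked, weaker than expert review.]

ANSWER TO Q6/056 FROM THE TREE: `stub_polyNoChain` does NOT accept the identity re-centring as stated (its chains are `succT`-chains and `succT`
hard-codes `prep d X = shift d X (prepPsi d X)`), but its proof does — hence this port: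
* `succTSel d ψsel A` — Σ**_d with the re-centring after a shear chosen by a SELECTOR `ψsel` (`succT d = succTSel d (prepPsi d)`, `succT_eq_succTSel`);
  `IsNeutralStepSel`; `paramSel` / `SlabSel` / `AhatSel` (the tail bookkeeping of ρ-T with the selector); `PolyRelSel` (the regime descent relation);
* **the LAZY selector** `prepSelWP d X := if WellPrepared d X then 0 else prepPsi d X` and `succTWP d := succTSel d (prepSelWP d)`:
  `isPrepRecentring_zero` (the identity re-centring is well-preparing on a well-prepared position), `isPrepRecentring_prepSelWP` (the lazy selector is
  ADMISSIBLE given ρ-P);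
* **labels with `A₀ = 0`** (the sub-regime `y ∈ O`): `wellPrepared_of_apply_zero_eq_zero` (056 / res-L1-w43-strat-1 §2 (iv): `vertexCoeff₀ = 0 = λ^d`),
  persistence `blowOneT/blowTwoT/divOneT/divTwoT/shearT_apply_zero`, **`apply_zero_eq_zero_of_mem_succTWP`** and **`mem_succTWP_iff_of_apply_zero_eq_zero`**
  (the lazy strategy is PREP-FREE there — `y` stays a straight boundary letter), and the graph branch
  **`isPermissibleTwoT_shearT_graphShearT_of_apply_zero_eq_zero`** (the prep-free graph curve `V(y, u₂ + u₁h)` IS permissible, by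
  `isPermissibleTwoT_of_wellPrepared_of_isPermissibleTwoT_shift`).
Parts 2/3 (…PolyDescentSelTail, …PolyDescentSelNoChain): `polyNoChainSel` for EVERY admissible selector, `polyNoChainWP'` unconditional, the
well-founded lazy descent relation and its exits.
-/

set_option linter.dupNamespace false -- mandated namespace of this single-conjunct summit

noncomputable section

namespace Summit.ResolutionOfSingularities.ResolutionOfSingularities.Theorems

namespace PolyDescent

open MvPowerSeries MonicDescent WildMonic Literature.RingTheory.TwoVariableSeries Literature.AlgebraicGeometry.Resolution

variable {k : Type} [Field k]

/-! ## PART 1 (DEFS): the strategy with a preparation selector -/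

open Classical in
/-- THE SUCCESSOR LABELS OF Σ**_d WITH A PREPARATION SELECTOR `ψsel`: verbatim `succT`, except that after a shear the label `X` is re-centred by
`ψsel X` instead of the `ε`-chosen `prepPsi d X` (`succT d = succTSel d (prepPsi d)`, `succT_eq_succTSel`). -/
def succTSel (d : ℕ) (ψsel : (Fin d → MvPowerSeries (Fin 2) k) → MvPowerSeries (Fin 2) k) (A : Fin d → MvPowerSeries (Fin 2) k) :
    Set (Fin d → MvPowerSeries (Fin 2) k) :=
  if IsPermissibleOneT d A then {divOneT d A}
  else if IsPermissibleTwoT d A then {divTwoT d A}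
  else if HasGraphCurveT d A then {divTwoT d (shift d (shearT (graphShearT d A) A) (ψsel (shearT (graphShearT d A) A)))}
  else {blowOneT d A, blowTwoT d A} ∪ {B | ∃ c : k, c ≠ 0 ∧ B = blowOneT d (shift d (shearT (C c) A) (ψsel (shearT (C c) A)))}

/-- The β-NEUTRAL STEPS of the selector strategy. -/
def IsNeutralStepSel (d : ℕ) (ψsel : (Fin d → MvPowerSeries (Fin 2) k) → MvPowerSeries (Fin 2) k) (X Y : Fin d → MvPowerSeries (Fin 2) k) : Prop :=
  (IsPermissibleOneT d X ∧ Y = divOneT d X) ∨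
  (¬ IsPermissibleOneT d X ∧ ¬ IsPermissibleTwoT d X ∧ ¬ HasGraphCurveT d X ∧
    (Y = blowOneT d X ∨ ∃ c : k, c ≠ 0 ∧ Y = blowOneT d (shift d (shearT (C c) X) (ψsel (shearT (C c) X)))))

open Classical in
/-- THE LAZY SELECTOR: do not touch a well-prepared label, otherwise prepare it (`prepPsi`). -/
def prepSelWP (d : ℕ) (X : Fin d → MvPowerSeries (Fin 2) k) : MvPowerSeries (Fin 2) k :=
  if WellPrepared d X then 0 else prepPsi d X

/-- Σ**_d with lazy preparation. -/
def succTWP (d : ℕ) (A : Fin d → MvPowerSeries (Fin 2) k) : Set (Fin d → MvPowerSeries (Fin 2) k) := succTSel d (prepSelWP d) A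

section TailDefs

variable {d : ℕ} (ψsel : (Fin d → MvPowerSeries (Fin 2) k) → MvPowerSeries (Fin 2) k) (A : ℕ → (Fin d → MvPowerSeries (Fin 2) k))

open Classical in
/-- The PARAMETER `λ_m` of step `m` of a selector chain: the `c` of a `(1:c)` point step, `0` otherwise. -/
def paramSel (m : ℕ) : k :=
  if h : IsPointStepT A m ∧ ∃ c : k, c ≠ 0 ∧ A (m + 1) = blowOneT d (shift d (shearT (C c) (A m)) (ψsel (shearT (C c) (A m))))
  then Classical.choose h.2 else 0

variable (hex : ∀ m, ∃ n, m ≤ n ∧ IsPointStepT A n)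

/-- The STRAIGHTENED label `S m = (A m)(u₁, u₂ + u₁·hser m)` of a selector chain. -/
def SlabSel (m : ℕ) : Fin d → MvPowerSeries (Fin 2) k := shearT (hser (IsPointStepT A) (paramSel ψsel A) hex m) (A m)

/-- The RE-CENTRED STRAIGHTENED label `Â m = shift (S m) (ψsel (S m))`. -/
def AhatSel (m : ℕ) : Fin d → MvPowerSeries (Fin 2) k := shift d (SlabSel ψsel A hex m) (ψsel (SlabSel ψsel A hex m))

end TailDefs

/-- THE LABELS OF THE REGIME and THE DESCENT RELATION of the selector strategy (verbatim `PolyRel` over `succTSel`). -/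
def PolyRelSel (d : ℕ) (ψsel : (Fin d → MvPowerSeries (Fin 2) k) → MvPowerSeries (Fin 2) k) (A' A : Fin d → MvPowerSeries (Fin 2) k) : Prop :=
  A' ∈ succTSel d ψsel A ∧ InPoly d A ∧ InPoly d A'

/-! ### Unfoldings -/

/-- `succT` is the selector strategy with the `ε`-chosen preparation. -/
theorem succT_eq_succTSel (d : ℕ) (A : Fin d → MvPowerSeries (Fin 2) k) : succT d A = succTSel d (prepPsi d) A := rfl

/-- Unfolding, case (a′) `V(y,u₁)`. -/
theorem succTSel_of_isPermissibleOneT {d : ℕ} (ψsel : (Fin d → MvPowerSeries (Fin 2) k) → MvPowerSeries (Fin 2) k)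
    {A : Fin d → MvPowerSeries (Fin 2) k} (h : IsPermissibleOneT d A) : succTSel d ψsel A = {divOneT d A} := by
  unfold succTSel; rw [if_pos h]

/-- Unfolding, case (a′) `V(y,u₂)`. -/
theorem succTSel_of_isPermissibleTwoT {d : ℕ} (ψsel : (Fin d → MvPowerSeries (Fin 2) k) → MvPowerSeries (Fin 2) k)
    {A : Fin d → MvPowerSeries (Fin 2) k} (h1 : ¬ IsPermissibleOneT d A) (h2 : IsPermissibleTwoT d A) :
    succTSel d ψsel A = {divTwoT d A} := by
  unfold succTSel; rw [if_neg h1, if_pos h2]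

/-- Unfolding, case (a″). -/
theorem succTSel_of_hasGraphCurveT {d : ℕ} (ψsel : (Fin d → MvPowerSeries (Fin 2) k) → MvPowerSeries (Fin 2) k)
    {A : Fin d → MvPowerSeries (Fin 2) k} (h1 : ¬ IsPermissibleOneT d A) (h2 : ¬ IsPermissibleTwoT d A) (h3 : HasGraphCurveT d A) :
    succTSel d ψsel A = {divTwoT d (shift d (shearT (graphShearT d A) A) (ψsel (shearT (graphShearT d A) A)))} := by
  unfold succTSel; rw [if_neg h1, if_neg h2, if_pos h3]

/-- Unfolding, case (b). -/
theorem succTSel_of_point {d : ℕ} (ψsel : (Fin d → MvPowerSeries (Fin 2) k) → MvPowerSeries (Fin 2) k)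
    {A : Fin d → MvPowerSeries (Fin 2) k} (h1 : ¬ IsPermissibleOneT d A) (h2 : ¬ IsPermissibleTwoT d A) (h3 : ¬ HasGraphCurveT d A) :
    succTSel d ψsel A = {blowOneT d A, blowTwoT d A} ∪
      {B | ∃ c : k, c ≠ 0 ∧ B = blowOneT d (shift d (shearT (C c) A) (ψsel (shearT (C c) A)))} := by
  unfold succTSel; rw [if_neg h1, if_neg h2, if_neg h3]

/-- The lazy selector on a well-prepared label. -/
theorem prepSelWP_of_wellPrepared {d : ℕ} {X : Fin d → MvPowerSeries (Fin 2) k} (h : WellPrepared d X) : prepSelWP d X = 0 := by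
  unfold prepSelWP; rw [if_pos h]

/-- The lazy selector on a label that is not well-prepared. -/
theorem prepSelWP_of_not_wellPrepared {d : ℕ} {X : Fin d → MvPowerSeries (Fin 2) k} (h : ¬ WellPrepared d X) :
    prepSelWP d X = prepPsi d X := by
  unfold prepSelWP; rw [if_neg h]

/-! ## PART 2: admissible selectors; the lazy selector; labels with `A₀ = 0` -/

/-- THE IDENTITY RE-CENTRING IS WELL-PREPARING ON A WELL-PREPARED POSITION. -/
theorem isPrepRecentring_zero {d : ℕ} {A : Fin d → MvPowerSeries (Fin 2) k} (hpos : IsPosT d A) (hWP : WellPrepared d A) :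
    IsPrepRecentring d A 0 := by
  refine ⟨map_zero _, ?_, ?_, fun P hP _ => ?_⟩
  · rw [shift_zero']; exact hpos
  · rw [shift_zero']; exact hWP
  · rw [shift_zero']; exact ⟨hP, fun j => rfl⟩

/-- THE LAZY SELECTOR IS ADMISSIBLE given Hironaka's vertex preparation (ρ-P) as a hypothesis. -/
theorem isPrepRecentring_prepSelWP {d : ℕ}
    (hprep : ∀ A : Fin d → MvPowerSeries (Fin 2) k, IsPosT d A → ∃ ψ : MvPowerSeries (Fin 2) k, IsPrepRecentring d A ψ)
    {X : Fin d → MvPowerSeries (Fin 2) k} (hpos : IsPosT d X) : IsPrepRecentring d X (prepSelWP d X) := by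
  by_cases h : WellPrepared d X
  · rw [prepSelWP_of_wellPrepared h]; exact isPrepRecentring_zero hpos h
  · rw [prepSelWP_of_not_wellPrepared h]; exact isPrepRecentring_prepPsi (hprep X hpos)

/-- **A LABEL WITH `A₀ = 0` IS WELL-PREPARED** (`d ≥ 1`): a solvable vertex `P` would have vertex polynomial `(Y + λ)^d`, whose constant term `λ^d`
is the slot-`0` vertex coefficient `= 0`; so `λ = 0` and every vertex coefficient of `P` vanishes — but a point of the Newton set carries a non-zero
one. -/
theorem wellPrepared_of_apply_zero_eq_zero {d : ℕ} (hd : 0 < d) {A : Fin d → MvPowerSeries (Fin 2) k} (h0 : A ⟨0, hd⟩ = 0) :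
    WellPrepared d A := by
  intro P hPv hsolv
  obtain ⟨-, la, hla⟩ := hsolv
  have hv0 : vertexCoeff d A P ⟨0, hd⟩ = 0 := by
    by_cases hdvd : ∀ i, slotWeight d ((⟨0, hd⟩ : Fin d) : ℕ) ∣ P i
    · rw [vertexCoeff_of_dvd A hdvd, h0, map_zero]
    · exact vertexCoeff_of_not_dvd A hdvd
  have hla0 : la = 0 := by
    have h := hla ⟨0, hd⟩
    rw [hv0, Nat.choose_zero_right, Nat.cast_one, one_mul, Nat.sub_zero] at h
    exact pow_eq_zero_iff (n := d) (by omega) |>.mp h.symm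
  obtain ⟨j, hj⟩ := exists_vertexCoeff_ne_zero_of_mem hPv.1
  apply hj
  rw [hla j, hla0, zero_pow (Nat.sub_ne_zero_of_lt j.2), mul_zero]

/-! ### Persistence of `A₀ = 0` under the prep-free transports -/

/-- `blowTwo c 0 = 0`. -/
theorem blowTwo_zero (c : ℕ) : blowTwo c (0 : MvPowerSeries (Fin 2) k) = 0 := by
  ext e; rw [coeff_blowTwo]; split_ifs <;> simp

/-- `divOne c 0 = 0`. -/
theorem divOne_zero (c : ℕ) : divOne c (0 : MvPowerSeries (Fin 2) k) = 0 := by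
  ext e; rw [coeff_divOne]; simp

/-- `divTwo c 0 = 0`. -/
theorem divTwo_zero (c : ℕ) : divTwo c (0 : MvPowerSeries (Fin 2) k) = 0 := by
  ext e; rw [coeff_divTwo]; simp

/-- `shear h 0 = 0`. -/
theorem shear_zero_right (h : MvPowerSeries (Fin 2) k) : shear h (0 : MvPowerSeries (Fin 2) k) = 0 := by
  unfold shear
  rw [← coe_substAlgHom (hasSubst_of_constantCoeff_zero fun i => by fin_cases i <;> simp [constantCoeff_X]), map_zero]

/-- `A₀ = 0` persists under the `u₁`-chart of the point blow-up. -/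
theorem blowOneT_apply_zero {d : ℕ} (hd : 0 < d) {A : Fin d → MvPowerSeries (Fin 2) k} (h0 : A ⟨0, hd⟩ = 0) :
    blowOneT d A ⟨0, hd⟩ = 0 := by
  show blowOne _ (A ⟨0, hd⟩) = 0; rw [h0, blowOne_zero]

/-- `A₀ = 0` persists under the `u₂`-chart of the point blow-up. -/
theorem blowTwoT_apply_zero {d : ℕ} (hd : 0 < d) {A : Fin d → MvPowerSeries (Fin 2) k} (h0 : A ⟨0, hd⟩ = 0) :
    blowTwoT d A ⟨0, hd⟩ = 0 := by
  show blowTwo _ (A ⟨0, hd⟩) = 0; rw [h0, blowTwo_zero]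

/-- `A₀ = 0` persists under the blow-up of `V(y,u₁)`. -/
theorem divOneT_apply_zero {d : ℕ} (hd : 0 < d) {A : Fin d → MvPowerSeries (Fin 2) k} (h0 : A ⟨0, hd⟩ = 0) :
    divOneT d A ⟨0, hd⟩ = 0 := by
  show divOne _ (A ⟨0, hd⟩) = 0; rw [h0, divOne_zero]

/-- `A₀ = 0` persists under the blow-up of `V(y,u₂)`. -/
theorem divTwoT_apply_zero {d : ℕ} (hd : 0 < d) {A : Fin d → MvPowerSeries (Fin 2) k} (h0 : A ⟨0, hd⟩ = 0) :
    divTwoT d A ⟨0, hd⟩ = 0 := by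
  show divTwo _ (A ⟨0, hd⟩) = 0; rw [h0, divTwo_zero]

/-- `A₀ = 0` persists under the `u₂`-shears. -/
theorem shearT_apply_zero {d : ℕ} (hd : 0 < d) (h : MvPowerSeries (Fin 2) k) {A : Fin d → MvPowerSeries (Fin 2) k} (h0 : A ⟨0, hd⟩ = 0) :
    shearT h A ⟨0, hd⟩ = 0 := by
  rw [shearT_apply, h0, shear_zero_right]

/-- **THE LAZY STRATEGY IS PREP-FREE ON LABELS WITH `A₀ = 0`, AND `A₀ = 0` PERSISTS**: every `B ∈ succTWP d A` of a label with `A₀ = 0` has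
`B₀ = 0` (no re-centring ever happens: the sheared labels have slot `0` zero, hence are well-prepared, and the lazy selector returns `0`). -/
theorem apply_zero_eq_zero_of_mem_succTWP {d : ℕ} (hd : 0 < d) {A B : Fin d → MvPowerSeries (Fin 2) k} (h0 : A ⟨0, hd⟩ = 0)
    (hB : B ∈ succTWP d A) : B ⟨0, hd⟩ = 0 := by
  unfold succTWP at hB
  by_cases h1 : IsPermissibleOneT d A
  · rw [succTSel_of_isPermissibleOneT _ h1, Set.mem_singleton_iff] at hB
    rw [hB]; exact divOneT_apply_zero hd h0
  by_cases h2 : IsPermissibleTwoT d A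
  · rw [succTSel_of_isPermissibleTwoT _ h1 h2, Set.mem_singleton_iff] at hB
    rw [hB]; exact divTwoT_apply_zero hd h0
  by_cases h3 : HasGraphCurveT d A
  · rw [succTSel_of_hasGraphCurveT _ h1 h2 h3, Set.mem_singleton_iff] at hB
    have hS0 := shearT_apply_zero hd (graphShearT d A) h0
    rw [hB, prepSelWP_of_wellPrepared (wellPrepared_of_apply_zero_eq_zero hd hS0), shift_zero']
    exact divTwoT_apply_zero hd hS0
  · rw [succTSel_of_point _ h1 h2 h3] at hB
    rcases hB with hB | ⟨c, -, rfl⟩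
    · rcases hB with rfl | rfl
      · exact blowOneT_apply_zero hd h0
      · exact blowTwoT_apply_zero hd h0
    · have hS0 := shearT_apply_zero hd (C c) h0
      rw [prepSelWP_of_wellPrepared (wellPrepared_of_apply_zero_eq_zero hd hS0), shift_zero']
      exact blowOneT_apply_zero hd hS0

/-- **THE LAZY STRATEGY ON LABELS WITH `A₀ = 0`, EXPLICITLY** (no `shift` anywhere): `V(y,u₁)` ↦ `A/u₁^{d−·}`; else `V(y,u₂)` ↦ `A/u₂^{d−·}`; else
a graph curve ↦ `(shear_h A)/ũ₂^{d−·}` with `h = graphShearT d A`; else the point: both charts and the `u₁`-charts of the sheared labels. -/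
theorem mem_succTWP_iff_of_apply_zero_eq_zero {d : ℕ} (hd : 0 < d) {A B : Fin d → MvPowerSeries (Fin 2) k} (h0 : A ⟨0, hd⟩ = 0) :
    B ∈ succTWP d A ↔
      (IsPermissibleOneT d A ∧ B = divOneT d A) ∨
      (¬ IsPermissibleOneT d A ∧ IsPermissibleTwoT d A ∧ B = divTwoT d A) ∨
      (¬ IsPermissibleOneT d A ∧ ¬ IsPermissibleTwoT d A ∧ HasGraphCurveT d A ∧ B = divTwoT d (shearT (graphShearT d A) A)) ∨
      (¬ IsPermissibleOneT d A ∧ ¬ IsPermissibleTwoT d A ∧ ¬ HasGraphCurveT d A ∧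
        (B = blowOneT d A ∨ B = blowTwoT d A ∨ ∃ c : k, c ≠ 0 ∧ B = blowOneT d (shearT (C c) A))) := by
  unfold succTWP
  by_cases h1 : IsPermissibleOneT d A
  · rw [succTSel_of_isPermissibleOneT _ h1, Set.mem_singleton_iff]; tauto
  by_cases h2 : IsPermissibleTwoT d A
  · rw [succTSel_of_isPermissibleTwoT _ h1 h2, Set.mem_singleton_iff]; tauto
  by_cases h3 : HasGraphCurveT d A
  · rw [succTSel_of_hasGraphCurveT _ h1 h2 h3, Set.mem_singleton_iff,
      prepSelWP_of_wellPrepared (wellPrepared_of_apply_zero_eq_zero hd (shearT_apply_zero hd (graphShearT d A) h0)), shift_zero']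
    tauto
  · rw [succTSel_of_point _ h1 h2 h3]
    have hsh : ∀ c : k, shift d (shearT (C c) A) (prepSelWP d (shearT (C c) A)) = shearT (C c) A := fun c => by
      rw [prepSelWP_of_wellPrepared (wellPrepared_of_apply_zero_eq_zero hd (shearT_apply_zero hd (C c) h0)), shift_zero']
    simp only [Set.mem_union, Set.mem_insert_iff, Set.mem_singleton_iff, Set.mem_setOf_eq, hsh]
    tauto

/-- **IN THE GRAPH BRANCH THE PREP-FREE GRAPH CURVE IS PERMISSIBLE** for a label with `A₀ = 0`: if some re-centred sheared label
`shift (shear_h A) ψ` is `V(y,ũ₂)`-permissible then so is `shear_h A` itself (it is well-prepared, having slot `0` zero;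
`isPermissibleTwoT_of_wellPrepared_of_isPermissibleTwoT_shift`) — the curve `V(y, u₂ + u₁h)` inside the plane `{y = 0}`. -/
theorem isPermissibleTwoT_shearT_of_apply_zero_eq_zero {d : ℕ} (hd : 0 < d) {A : Fin d → MvPowerSeries (Fin 2) k} (h0 : A ⟨0, hd⟩ = 0)
    {h ψ : MvPowerSeries (Fin 2) k} (hperm : IsPermissibleTwoT d (shift d (shearT h A) ψ)) : IsPermissibleTwoT d (shearT h A) :=
  isPermissibleTwoT_of_wellPrepared_of_isPermissibleTwoT_shift hd (wellPrepared_of_apply_zero_eq_zero hd (shearT_apply_zero hd h h0)) hperm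

/-- In particular with the `ε`-chosen graph shear: `HasGraphCurveT d A`, `A₀ = 0` ⇒ `V(y, u₂ + u₁·graphShearT A)` is permissible for `shear A`. -/
theorem isPermissibleTwoT_shearT_graphShearT_of_apply_zero_eq_zero {d : ℕ} (hd : 0 < d) {A : Fin d → MvPowerSeries (Fin 2) k}
    (h0 : A ⟨0, hd⟩ = 0) (h3 : HasGraphCurveT d A) : IsPermissibleTwoT d (shearT (graphShearT d A) A) := by
  obtain ⟨ψ, -, -, hperm⟩ := graphShearT_spec h3
  exact isPermissibleTwoT_shearT_of_apply_zero_eq_zero hd h0 hperm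


end PolyDescent

end Summit.ResolutionOfSingularities.ResolutionOfSingularities.Theorems

end
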